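import Mathlib
import Literature.NumberTheory.Automorphic.ResGLnKugaCuspidal
import Literature.NumberTheory.Automorphic.ResGLnKugaAdInvariance
import Literature.NumberTheory.Automorphic.ResGLnKugaHarmonicRel
import Literature.NumberTheory.Automorphic.ResGLnConeDictionaryCone
import Literature.NumberTheory.Automorphic.ResGLnCuspidalCohomologyApexLevel
import Summits.Langlands.Langlands.Theorems.IrreducibilityBySelfDualityHeckeEigenvalueFieldStubFDSlice
import HarnessLib

/-!
# Level-`𝔫` relative `(𝔤, K_∞)`-cochains have their tuple values in ONE finite-dimensional space —
crux HeckeEigenvalueField (stmt-Langlands-13632), line Sketch, stub END-FD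

Statement.  Let `π = W / ⊥` be a clean cuspidal automorphic representation datum of `GL_n(𝔸_K)`,
`𝔫 ≠ 0` a level, `E = E_λ(ℂ)` the coefficient module and `x = xD` the orthonormal basis of `𝔭₀`.
There is a finite-dimensional `ℂ`-subspace `Zs` of the tuple functions
`(Fin (q+1) → ι) → W ⊗ E` containing `I ↦ θ(x_{I 0}, …, x_{I q})` for EVERY `(q+1)`-cochain `θ` of the
`(𝔤, K_∞)`-complex `C^•(𝔤, K_∞; W ⊗ E)` whose values are `K(𝔫)`-fixed.

Proof (Borel–Wallach I §5.1 with Harish-Chandra's finiteness theorem, Borel–Jacquet 4.3 (i)).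
Write a value `θ(v) = ∑ᵢ wᵢ ⊗ eᵢ` in a basis `(eᵢ)` of `E`; the coordinates `wᵢ ∈ W` are
`K(𝔫)`-invariant cusp forms (`IsLevelFixed`: the values are fixed by `r(u) ⊗ 1`, `u ∈ K_f(𝔫)`, and
`K(𝔫) = {1} × K_f(𝔫)`), and their `K_∞`-slices are MATRIX COEFFICIENTS of the finite-dimensional
representation `R` of `K_∞` on `Mult_ℝ(𝔤^{q+1}, E)`, `(R_k Ψ)(v) = E(k)⁻¹ Ψ(Ad(k) v)`:
`K_∞`-fixedness of `θ` under `Ad ⊗ (r ⊗ E)` gives `θ(v)(g k) = E(k)⁻¹ θ(Ad(k) v)(g)`, i.e.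
`wᵢ(g k) = eᵢ^*(R_k Ψ_{θ,g}(v))` with `Ψ_{θ,g}(v) = θ(v)(g)`.  The space `M` of all matrix coefficients
`k ↦ L(R_k)` is finite-dimensional and right-`K_∞`-stable (`R_{k k₀} = R_{k₀} R_k`), so by the landed
FD-SLICE (`stub_finiteDimensional_levelKSlice`: Harish-Chandra finiteness at level `K(𝔫)`,
infinitesimal character of `π` and `K_∞`-slices in `M`) all the `wᵢ` lie in ONE finite-dimensional
`T ≤ Fun(GL_n(𝔸_K), ℂ)`; hence every value `θ(v)` lies in the image of `(T ∩ W) ⊗ E`, and the tuple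
functions lie in the finite-dimensional `Zs = ∏_I image((T ∩ W) ⊗ E)`.
-/

set_option linter.dupNamespace false -- project-wide: `Summit.Langlands.Langlands` is the mandated namespace

noncomputable section

open scoped TensorProduct Classical Matrix ComplexConjugate
open MeasureTheory NumberField NumberField.mixedEmbedding
open Literature.NumberTheory.Automorphic Literature.Algebra.Lie Literature.Algebra.Lie.ChevalleyEilenberg

namespace Summit.Langlands.Langlands.Theorems.HeckeEigenvalueField.Res

namespace EndFD

/-! ### Coordinates of a tensor in a basis of the right factor -/

/-- Naturality of the `μ`-coordinate `t ↦ (rid ∘ (1 ⊗ μ)) t` of a tensor in the left factor: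
the coordinate of `(f ⊗ 1) t` is `f` of the coordinate of `t`. [folklore] -/
theorem rid_lTensor_rTensor {R : Type*} [CommSemiring R] {M N : Type*} [AddCommMonoid M] [Module R M]
    [AddCommMonoid N] [Module R N] (μ : N →ₗ[R] R) (f : M →ₗ[R] M) (t : M ⊗[R] N) :
    TensorProduct.rid R M (μ.lTensor M (f.rTensor N t)) = f (TensorProduct.rid R M (μ.lTensor M t)) := by
  induction t using TensorProduct.induction_on with
  | zero => simp only [map_zero]
  | tmul m x =>
    simp only [LinearMap.rTensor_tmul, LinearMap.lTensor_tmul, TensorProduct.rid_tmul, map_smul]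
  | add t t' ht ht' => simp only [map_add, ht, ht']

/-- Reconstruction of a tensor from its coordinates in a finite basis `b` of the right factor:
`t = ∑ᵢ tᵢ ⊗ bᵢ` with `tᵢ = (rid ∘ (1 ⊗ bᵢ^*)) t`. [folklore] -/
theorem sum_rid_lTensor_coord_tmul {R : Type*} [CommSemiring R] {M N : Type*} [AddCommMonoid M]
    [Module R M] [AddCommMonoid N] [Module R N] {ι : Type*} [Fintype ι] (b : Module.Basis ι R N)
    (t : M ⊗[R] N) :
    ∑ i, (TensorProduct.rid R M ((b.coord i).lTensor M t)) ⊗ₜ[R] b i = t := by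
  induction t using TensorProduct.induction_on with
  | zero => simp only [map_zero, TensorProduct.zero_tmul, Finset.sum_const_zero]
  | tmul m x =>
    simp only [LinearMap.lTensor_tmul, TensorProduct.rid_tmul, Module.Basis.coord_apply,
      TensorProduct.smul_tmul]
    rw [← TensorProduct.tmul_sum, b.sum_repr]
  | add t t' ht ht' =>
    simp only [map_add, TensorProduct.add_tmul, Finset.sum_add_distrib, ht, ht']

/-- The `μ`-coordinate of `t ∈ W ⊗ E`, as a function on `GL_n(𝔸_K)`, is `μ` of the `E`-valued
function `evalTensor t` of `t`. [cite: BorelWallach2000, VII 2.2] -/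
theorem coe_rid_lTensor_apply {n : ℕ} {K : Type} [Field K] [NumberField K]
    {hcpt : isCompact_glFiniteIntegralLevel n K} (π : AutomorphicRepData (AutomorphyDatum.gl n K hcpt))
    {E : Type*} [AddCommGroup E] [Module ℂ E] (μ : E →ₗ[ℂ] ℂ) (t : π.W ⊗[ℂ] E)
    (x : (AdelicGroupData.gl n K).Adelic) :
    ((TensorProduct.rid ℂ π.W (μ.lTensor π.W t) : π.W) : (AdelicGroupData.gl n K).Adelic → ℂ) x =
      μ (π.evalTensor E t x) := by
  induction t using TensorProduct.induction_on with
  | zero => simp only [map_zero, ZeroMemClass.coe_zero, Pi.zero_apply]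
  | tmul ψ e =>
    rw [LinearMap.lTensor_tmul, TensorProduct.rid_tmul, AutomorphicRepData.evalTensor_tmul, map_smul,
      Submodule.coe_smul, Pi.smul_apply, smul_eq_mul, smul_eq_mul, mul_comm]
  | add t t' ht ht' => simp only [map_add, Submodule.coe_add, Pi.add_apply, ht, ht']

/-! ### The two invariance properties of the coordinates of the values of a cochain -/

/-- **`K_∞`-fixedness, evaluated**: for a cochain `θ` of the `(𝔤, K_∞)`-complex (fixed by
`Ad ⊗ (r ⊗ E)`), `θ(v)(g k) = E(k)⁻¹ · θ(Ad(k) v)(g)` for `k ∈ K_∞`, `g ∈ GL_n(𝔸_K)`.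
[cite: BorelWallach2000, I §5.1 (3)] -/
theorem evalTensor_apply_mul_ofK {n : ℕ} {K : Type} [Field K] [NumberField K]
    {hcpt : isCompact_glFiniteIntegralLevel n K} (π : AutomorphicRepData (AutomorphyDatum.gl n K hcpt))
    (S : Finset {w : InfinitePlace K // w.IsReal}) (lam : (K →+* ℂ) → Fin n → ℤ) {q : ℕ}
    {θ : ConeDictionary.Cochain π lam (q + 1)}
    (hθ : θ ∈ (ConeDictionary.gkComplexLS π S lam).carrier (q + 1))
    (k : (AutomorphyDatum.gl n K hcpt).arch.maximalCompact) (g : (AdelicGroupData.gl n K).Adelic)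
    (v : Fin (q + 1) → (AutomorphyDatum.gl n K hcpt).arch.lie) :
    π.evalTensor (ResGLnCohomology.CoeffModule ℂ n K lam)
        (@id (π.W ⊗[ℂ] ResGLnCohomology.CoeffModule ℂ n K lam) (θ v))
        (g * (AutomorphyDatum.gl n K hcpt).ofK k) =
      ConeDictionary.σSK hcpt S lam k⁻¹
        (π.evalTensor (ResGLnCohomology.CoeffModule ℂ n K lam)
          (@id (π.W ⊗[ℂ] ResGLnCohomology.CoeffModule ℂ n K lam)
            (θ fun j => (AutomorphyDatum.gl n K hcpt).arch.Ad
              (Subgroup.inclusion (AutomorphyDatum.gl n K hcpt).arch.maximalCompact_le_carrier k) (v j)))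
          g) := by
  have hfix := ((mem_gkComplex_succ_iff (AutomorphyDatum.gl n K hcpt).arch _ _ _ q θ).1 hθ).2 k⁻¹
  -- fixedness under `k⁻¹`: `(r(k⁻¹) ⊗ E(k⁻¹)) (θ (Ad(k) v)) = θ v`
  have hk : (π.kRepW.tprod (ConeDictionary.σSK hcpt S lam)) k⁻¹
      (@id (π.W ⊗[ℂ] ResGLnCohomology.CoeffModule ℂ n K lam)
        (θ fun j => (AutomorphyDatum.gl n K hcpt).arch.Ad
          (Subgroup.inclusion (AutomorphyDatum.gl n K hcpt).arch.maximalCompact_le_carrier k) (v j))) =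
      @id (π.W ⊗[ℂ] ResGLnCohomology.CoeffModule ℂ n K lam) (θ v) := by
    have h0 := congrArg (fun f => f v) hfix
    rw [PairAction.act_apply, inv_inv] at h0
    exact h0
  have h1 : π.evalTensor (ResGLnCohomology.CoeffModule ℂ n K lam)
      ((π.kRepW.tprod (ConeDictionary.σSK hcpt S lam)) k⁻¹
        (@id (π.W ⊗[ℂ] ResGLnCohomology.CoeffModule ℂ n K lam)
          (θ fun j => (AutomorphyDatum.gl n K hcpt).arch.Ad
            (Subgroup.inclusion (AutomorphyDatum.gl n K hcpt).arch.maximalCompact_le_carrier k) (v j))))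
        (g * (AutomorphyDatum.gl n K hcpt).ofK k) =
      π.evalTensor (ResGLnCohomology.CoeffModule ℂ n K lam)
        (@id (π.W ⊗[ℂ] ResGLnCohomology.CoeffModule ℂ n K lam) (θ v))
        (g * (AutomorphyDatum.gl n K hcpt).ofK k) := by
    rw [hk]
  rw [ConeDictionary.evalTensor_tprod_σSK, mul_assoc, ← map_mul, mul_inv_cancel, map_one, mul_one] at h1
  exact h1.symm

/-- **Level invariance of the coordinates**: if the values of `θ` are `K(𝔫)`-fixed
(`IsLevelFixed`: fixed by `r(u) ⊗ 1`, `u ∈ K_f(𝔫)`; `K(𝔫) = {1} × K_f(𝔫)`), every coordinate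
`wᵢ ∈ W` of every value `θ(v) = ∑ wᵢ ⊗ eᵢ` is a `K(𝔫)`-invariant function.
[cite: BorelJacquetCorvallis1979, 4.6] -/
theorem rightTranslation_coord_of_isLevelFixed {n : ℕ} {K : Type} [Field K] [NumberField K]
    {hcpt : isCompact_glFiniteIntegralLevel n K} (π : AutomorphicRepData (AutomorphyDatum.gl n K hcpt))
    (lam : (K →+* ℂ) → Fin n → ℤ) {𝔫 : Ideal (𝓞 K)} {q : ℕ} {θ : ConeDictionary.Cochain π lam q}
    (hlev : ConeDictionary.IsLevelFixed π lam 𝔫 θ) (μ : ResGLnCohomology.CoeffModule ℂ n K lam →ₗ[ℂ] ℂ)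
    (v : Fin q → (AutomorphyDatum.gl n K hcpt).arch.lie) {u : (AdelicGroupData.gl n K).Adelic}
    (hu : u ∈ principalCongruenceLevel n K 𝔫) :
    rightTranslation (AdelicGroupData.gl n K) u
        ((TensorProduct.rid ℂ π.W (μ.lTensor π.W
          (@id (π.W ⊗[ℂ] ResGLnCohomology.CoeffModule ℂ n K lam) (θ v))) : π.W) :
          (AdelicGroupData.gl n K).Adelic → ℂ) =
      ((TensorProduct.rid ℂ π.W (μ.lTensor π.W
          (@id (π.W ⊗[ℂ] ResGLnCohomology.CoeffModule ℂ n K lam) (θ v))) : π.W) :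
          (AdelicGroupData.gl n K).Adelic → ℂ) := by
  have hu' : u ∈ (finitePrincipalCongruenceLevel n K 𝔫).map (GLn.ofFinite n K) := by
    rw [map_ofFinite_finitePrincipalCongruenceLevel]
    exact hu
  obtain ⟨u', hu'mem, rfl⟩ := Subgroup.mem_map.1 hu'
  have key : ((TensorProduct.rid ℂ π.W (μ.lTensor π.W
      ((π.finiteRepW ⟨GLn.ofFinite n K u', u', rfl⟩).rTensor (ResGLnCohomology.CoeffModule ℂ n K lam)
        (@id (π.W ⊗[ℂ] ResGLnCohomology.CoeffModule ℂ n K lam) (θ v)))) : π.W) :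
        (AdelicGroupData.gl n K).Adelic → ℂ) =
      ((TensorProduct.rid ℂ π.W (μ.lTensor π.W
        (@id (π.W ⊗[ℂ] ResGLnCohomology.CoeffModule ℂ n K lam) (θ v))) : π.W) :
        (AdelicGroupData.gl n K).Adelic → ℂ) := by
    rw [hlev v u' hu'mem]
  rw [rid_lTensor_rTensor] at key
  -- `↑(π.finiteRepW h φ) = r(h) φ` (definitional)
  exact key

/-! ### The finite-dimensional space of matrix coefficients -/

/-- **Matrix coefficients of the twisted action on multilinear maps.**  For a group `Γ` acting on a
finite-dimensional real space `L` by `Ad` (multiplicatively) and on a finite-dimensional complex space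
`E` by `σ`, the functions `k ↦ μ(σ(k)⁻¹ Ψ(Ad(k) v₀, …, Ad(k) v_q))` (`Ψ` an `E`-valued real
multilinear form on `L`, `μ ∈ E^*`) all lie in ONE finite-dimensional right-translation-stable space of
functions on `Γ`: the space of matrix coefficients `k ↦ ℒ(R_k)` of the representation
`(R_k Ψ)(v) = σ(k)⁻¹ Ψ(Ad(k) v)` of `Γ` on `Mult_ℝ(L^{q+1}, E)` (`R_{k k₀} = R_{k₀} ∘ R_k`).
[cite: BorelJacquetCorvallis1979, 4.3 (i)] -/
theorem exists_matrixCoeff_submodule {Γ : Type*} [Group Γ] {L : Type*} [AddCommGroup L] [Module ℝ L]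
    [Module.Finite ℝ L] {E : Type*} [AddCommGroup E] [Module ℂ E] [FiniteDimensional ℂ E]
    (σ : Representation ℂ Γ E) (Ad : Γ → (L →ₗ[ℝ] L)) (hAd : ∀ g h, Ad (g * h) = Ad g ∘ₗ Ad h) (m : ℕ) :
    ∃ M : Submodule ℂ (Γ → ℂ), FiniteDimensional ℂ M ∧
      (∀ k₀ : Γ, ∀ f ∈ M, (fun k => f (k * k₀)) ∈ M) ∧
      ∀ (Ψ : MultilinearMap ℝ (fun _ : Fin m => L) E) (v : Fin m → L) (μ : E →ₗ[ℂ] ℂ),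
        (fun k => μ (σ k⁻¹ (Ψ fun j => Ad k (v j)))) ∈ M := by
  haveI : Module.Finite ℂ (MultilinearMap ℝ (fun _ : Fin m => L) E) :=
    Module.Finite.of_restrictScalars_finite ℝ ℂ _
  -- the twisted action `R_k Ψ = σ(k)⁻¹ ∘ Ψ ∘ Ad(k)^{⊗ m}`, a `ℂ`-linear endomorphism
  let R : Γ → (MultilinearMap ℝ (fun _ : Fin m => L) E →ₗ[ℂ] MultilinearMap ℝ (fun _ : Fin m => L) E) :=
    fun k =>
      { toFun := fun Ψ => ((σ k⁻¹).restrictScalars ℝ).compMultilinearMap (Ψ.compLinearMap fun _ => Ad k)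
        map_add' := fun Ψ Ψ' => by
          ext w
          simp only [LinearMap.compMultilinearMap_apply, MultilinearMap.compLinearMap_apply,
            add_apply, map_add]
        map_smul' := fun c Ψ => by
          ext w
          simp only [LinearMap.compMultilinearMap_apply, MultilinearMap.compLinearMap_apply,
            smul_apply, LinearMap.coe_restrictScalars, map_smul, RingHom.id_apply] }
  have hR : ∀ k k₀ : Γ, R (k * k₀) = R k₀ * R k := by
    intro k k₀
    refine LinearMap.ext fun Ψ => MultilinearMap.ext fun w => ?_
    change σ (k * k₀)⁻¹ (Ψ fun j => Ad (k * k₀) (w j)) = σ k₀⁻¹ (σ k⁻¹ (Ψ fun j => Ad k (Ad k₀ (w j))))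
    rw [mul_inv_rev, map_mul, Module.End.mul_apply, hAd]
    rfl
  -- the matrix coefficients `k ↦ ℒ(R_k)`
  let Λ : ((MultilinearMap ℝ (fun _ : Fin m => L) E →ₗ[ℂ] MultilinearMap ℝ (fun _ : Fin m => L) E) →ₗ[ℂ] ℂ) →ₗ[ℂ]
      (Γ → ℂ) :=
    { toFun := fun ℒ k => ℒ (R k)
      map_add' := fun _ _ => rfl
      map_smul' := fun _ _ => rfl }
  refine ⟨LinearMap.range Λ, inferInstance, ?_, ?_⟩
  · rintro k₀ f ⟨ℒ, rfl⟩
    refine ⟨ℒ ∘ₗ LinearMap.mulLeft ℂ (R k₀), funext fun k => ?_⟩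
    change ℒ (R k₀ * R k) = ℒ (R (k * k₀))
    rw [hR]
  · intro Ψ v μ
    refine ⟨{ toFun := fun T => μ (T Ψ v)
              map_add' := fun T T' => by
                simp only [LinearMap.add_apply, add_apply, map_add]
              map_smul' := fun c T => by
                simp only [LinearMap.smul_apply, smul_apply, map_smul, RingHom.id_apply] },
      funext fun k => ?_⟩
    rfl

/-! ### The pieces over the `GL_n` datum -/

/-- **The `K_∞`-slices of the coordinates are matrix coefficients**: for a cochain `θ` of the
`(𝔤, K_∞)`-complex, `μ ∈ E^*`, `v ∈ 𝔤^{q+1}` and `g ∈ GL_n(𝔸_K)`, the slice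
`k ↦ w_μ(g k)` of the `μ`-coordinate `w_μ` of `θ(v)` is `k ↦ μ(E(k)⁻¹ Ψ(Ad(k) v))` for the real
multilinear `E`-valued form `Ψ = Ψ_{θ,g} : v ↦ θ(v)(g)`. [cite: BorelWallach2000, I §5.1 (3)] -/
theorem exists_slice_coord_eq {n : ℕ} {K : Type} [Field K] [NumberField K]
    {hcpt : isCompact_glFiniteIntegralLevel n K} (π : AutomorphicRepData (AutomorphyDatum.gl n K hcpt))
    (S : Finset {w : InfinitePlace K // w.IsReal}) (lam : (K →+* ℂ) → Fin n → ℤ) {q : ℕ}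
    {θ : ConeDictionary.Cochain π lam (q + 1)}
    (hθ : θ ∈ (ConeDictionary.gkComplexLS π S lam).carrier (q + 1))
    (μ : ResGLnCohomology.CoeffModule ℂ n K lam →ₗ[ℂ] ℂ)
    (v : Fin (q + 1) → (AutomorphyDatum.gl n K hcpt).arch.lie) (g : (AdelicGroupData.gl n K).Adelic) :
    ∃ Ψ : MultilinearMap ℝ (fun _ : Fin (q + 1) => (AutomorphyDatum.gl n K hcpt).arch.lie)
        (ResGLnCohomology.CoeffModule ℂ n K lam),
      (fun k : (AutomorphyDatum.gl n K hcpt).arch.maximalCompact =>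
        ((TensorProduct.rid ℂ π.W (μ.lTensor π.W
          (@id (π.W ⊗[ℂ] ResGLnCohomology.CoeffModule ℂ n K lam) (θ v))) : π.W) :
            (AdelicGroupData.gl n K).Adelic → ℂ) (g * (AutomorphyDatum.gl n K hcpt).ofK k)) =
      fun k : (AutomorphyDatum.gl n K hcpt).arch.maximalCompact =>
        μ (ConeDictionary.σSK hcpt S lam k⁻¹
          (Ψ fun j => (AutomorphyDatum.gl n K hcpt).arch.Ad
            (Subgroup.inclusion (AutomorphyDatum.gl n K hcpt).arch.maximalCompact_le_carrier k) (v j))) := by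
  -- the `E`-valued evaluation at `g`, real-linear on the carrier of the complex
  let evg : ConeDictionary.Carrier π lam →ₗ[ℝ] ResGLnCohomology.CoeffModule ℂ n K lam :=
    { toFun := fun t => π.evalTensor (ResGLnCohomology.CoeffModule ℂ n K lam) t g
      map_add' := fun t t' => by
        rw [ConeDictionary.carrier_add_eq, map_add]
        rfl
      map_smul' := fun r t => by
        rw [ConeDictionary.carrier_smul_eq, map_smul]
        rfl }
  refine ⟨evg.compMultilinearMap
    (θ : MultilinearMap ℝ (fun _ : Fin (q + 1) => (AutomorphyDatum.gl n K hcpt).arch.lie)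
      (ConeDictionary.Carrier π lam)), funext fun k => ?_⟩
  rw [coe_rid_lTensor_apply, evalTensor_apply_mul_ofK π S lam hθ k g v]
  rfl

/-- **Every coordinate of every value of a level-fixed cochain of the complex lies in the
finite-dimensional `T`** of the landed FD-SLICE: it is a `K(𝔫)`-invariant element of `W`
(`rightTranslation_coord_of_isLevelFixed`) all of whose `K_∞`-slices are matrix coefficients
(`exists_slice_coord_eq`), hence lie in the space `M` of matrix coefficients.
[cite: BorelJacquetCorvallis1979, 4.3 (i)] -/
theorem coe_coord_mem {n : ℕ} {K : Type} [Field K] [NumberField K]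
    {hcpt : isCompact_glFiniteIntegralLevel n K} (π : AutomorphicRepData (AutomorphyDatum.gl n K hcpt))
    (S : Finset {w : InfinitePlace K // w.IsReal}) (lam : (K →+* ℂ) → Fin n → ℤ) {𝔫 : Ideal (𝓞 K)}
    {q : ℕ} {θ : ConeDictionary.Cochain π lam (q + 1)}
    (hθ : θ ∈ (ConeDictionary.gkComplexLS π S lam).carrier (q + 1))
    (hlev : ConeDictionary.IsLevelFixed π lam 𝔫 θ)
    {M : Submodule ℂ (Kinf n K → ℂ)}
    (hMmem : ∀ (Ψ : MultilinearMap ℝ (fun _ : Fin (q + 1) => (AutomorphyDatum.gl n K hcpt).arch.lie)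
        (ResGLnCohomology.CoeffModule ℂ n K lam))
      (v : Fin (q + 1) → (AutomorphyDatum.gl n K hcpt).arch.lie)
      (μ : ResGLnCohomology.CoeffModule ℂ n K lam →ₗ[ℂ] ℂ),
      (fun k : (AutomorphyDatum.gl n K hcpt).arch.maximalCompact =>
        μ (ConeDictionary.σSK hcpt S lam k⁻¹
          (Ψ fun j => (AutomorphyDatum.gl n K hcpt).arch.Ad
            (Subgroup.inclusion (AutomorphyDatum.gl n K hcpt).arch.maximalCompact_le_carrier k) (v j)))) ∈ M)
    {T : Submodule ℂ ((AdelicGroupData.gl n K).Adelic → ℂ)}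
    (hT : ∀ φ ∈ π.W,
      (∀ u ∈ principalCongruenceLevel n K 𝔫, rightTranslation (AdelicGroupData.gl n K) u φ = φ) →
        (∀ g : (AdelicGroupData.gl n K).Adelic,
          (fun k : Kinf n K => φ (g * (AutomorphyDatum.gl n K hcpt).ofK k)) ∈ M) →
          φ ∈ T)
    (μ : ResGLnCohomology.CoeffModule ℂ n K lam →ₗ[ℂ] ℂ) (v : Fin (q + 1) → (AutomorphyDatum.gl n K hcpt).arch.lie) :
    ((TensorProduct.rid ℂ π.W (μ.lTensor π.W
        (@id (π.W ⊗[ℂ] ResGLnCohomology.CoeffModule ℂ n K lam) (θ v))) : π.W) :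
          (AdelicGroupData.gl n K).Adelic → ℂ) ∈ T := by
  refine hT _ (SetLike.coe_mem _) (fun u hu => rightTranslation_coord_of_isLevelFixed π lam hlev μ v hu)
    fun g => ?_
  obtain ⟨Ψ, hΨ⟩ := exists_slice_coord_eq π S lam hθ μ v g
  have hmem := hMmem Ψ v μ
  rw [← hΨ] at hmem
  -- `Kinf n K` is `K_∞` of the datum (definitional)
  exact hmem

/-- **The space `M` of matrix coefficients for the `GL_n` datum**: a finite-dimensional
right-`K_∞`-stable space of functions on `K_∞ = Kinf n K` containing every
`k ↦ μ(E(k)⁻¹ Ψ(Ad(k) v))`, `Ψ ∈ Mult_ℝ(𝔤^{q+1}, E_λ(ℂ))`, `μ ∈ E_λ(ℂ)^*`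
(`exists_matrixCoeff_submodule` for `σ = σSK` and `Ad|_{K_∞}`, multiplicative by `Ad_mul`; `𝔤 ≤ M_n(K_∞)` is
finite-dimensional). [cite: BorelJacquetCorvallis1979, 4.3 (i)] -/
theorem exists_matrixCoeff_submodule_datum {n : ℕ} {K : Type} [Field K] [NumberField K]
    (hcpt : isCompact_glFiniteIntegralLevel n K) (S : Finset {w : InfinitePlace K // w.IsReal})
    (lam : (K →+* ℂ) → Fin n → ℤ) (q : ℕ) :
    ∃ M : Submodule ℂ (Kinf n K → ℂ), FiniteDimensional ℂ M ∧
      (∀ k₀ : Kinf n K, ∀ f ∈ M, (fun k => f (k * k₀)) ∈ M) ∧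
      ∀ (Ψ : MultilinearMap ℝ (fun _ : Fin (q + 1) => (AutomorphyDatum.gl n K hcpt).arch.lie)
          (ResGLnCohomology.CoeffModule ℂ n K lam))
        (v : Fin (q + 1) → (AutomorphyDatum.gl n K hcpt).arch.lie)
        (μ : ResGLnCohomology.CoeffModule ℂ n K lam →ₗ[ℂ] ℂ),
        (fun k : (AutomorphyDatum.gl n K hcpt).arch.maximalCompact =>
          μ (ConeDictionary.σSK hcpt S lam k⁻¹
            (Ψ fun j => (AutomorphyDatum.gl n K hcpt).arch.Ad
              (Subgroup.inclusion (AutomorphyDatum.gl n K hcpt).arch.maximalCompact_le_carrier k) (v j)))) ∈ M := by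
  -- `𝔤 ≤ M_n(K_∞)` is finite-dimensional
  haveI : Module.Finite ℝ (AutomorphyDatum.gl n K hcpt).arch.lie :=
    Module.Finite.of_injective
      ({ toFun := Subtype.val, map_add' := fun _ _ => rfl, map_smul' := fun _ _ => rfl } :
        (AutomorphyDatum.gl n K hcpt).arch.lie →ₗ[ℝ] Matrix (Fin n) (Fin n) (mixedSpace K))
      Subtype.val_injective
  obtain ⟨M, hMfin, hMstab, hMmem⟩ := exists_matrixCoeff_submodule
    (Γ := (AutomorphyDatum.gl n K hcpt).arch.maximalCompact) (ConeDictionary.σSK hcpt S lam)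
    (fun k => ((AutomorphyDatum.gl n K hcpt).arch.Ad
      (Subgroup.inclusion (AutomorphyDatum.gl n K hcpt).arch.maximalCompact_le_carrier k) :
        (AutomorphyDatum.gl n K hcpt).arch.lie →ₗ[ℝ] (AutomorphyDatum.gl n K hcpt).arch.lie))
    (fun g h => by rw [map_mul, RealMatrixGroup.Ad_mul]; rfl) (q + 1)
  exact ⟨M, hMfin, hMstab, hMmem⟩

end EndFD

set_option maxHeartbeats 400000 in
-- the statement's instance synthesis on the tuple-cochain function type uses most of the default budget
set_option synthInstance.maxHeartbeats 400000 in
-- heavy instance synthesis on the tuple-cochain function type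
/-- **Stub END-FD — the level-`𝔫` relative cochains span a finite-dimensional space of tuple values.**
There is a finite-dimensional `ℂ`-subspace of tuple cochains `(Fin (q+1) → ι) → W ⊗ E_λ` containing the
`xD`-tuple values of every `(𝔤, K_∞)`-cochain which is `K'`-relative and has `K(𝔫)`-fixed values: the
`W`-components of the values are `K(𝔫)`-invariant cusp forms whose `K_∞`-slices `k ↦ φ(gk)` lie in the
finite-dimensional `K_∞`-stable space of matrix coefficients of `∧^{q+1} 𝔭 ⊗ E_λ` (by `K_∞`-fixedness of
the cochain), hence lie in a finite-dimensional space by the landed FD-SLICE (Harish-Chandra finiteness,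
`stub_finiteDimensional_levelKSlice`); tensoring with `E_λ` and taking finitely many tuples keeps finite
dimension. [cite: BorelJacquetCorvallis1979, 4.3 (i)] [cite: HarishChandra1968, Thm. 1] [cite: BorelWallach2000, I §5.1] -/
theorem stub_end_finiteDimensional {n : ℕ} {K : Type} [Field K] [NumberField K]
    (hcpt : isCompact_glFiniteIntegralLevel n K) (𝔫 : Ideal (𝓞 K)) (h𝔫 : 𝔫 ≠ 0)
    (π : CuspidalAutomorphicRepData n K hcpt) (hbot : π.1.W' = ⊥)
    (S : Finset {w : InfinitePlace K // w.IsReal}) (lam : (K →+* ℂ) → Fin n → ℤ) (q : ℕ) :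
    ∃ Zs : Submodule ℂ ((Fin (q + 1) → Fin (ResGLnCartan.pZeroDim n K)) → π.1.W ⊗[ℂ] ResGLnCohomology.CoeffModule ℂ n K lam),
      Module.Finite ℂ Zs ∧
      ∀ θ : ConeDictionary.Cochain π.1 lam (q + 1),
      (θ ∈ (ConeDictionary.gkComplexLS π.1 S lam).carrier (q + 1)) →
      (θ ∈ (Subcomplex.rel ℝ (ConeDictionary.𝔤D n K hcpt) (ConeDictionary.Carrier π.1 lam)
        (ConeDictionary.kPrimeD n K hcpt)).carrier (q + 1)) →
      ConeDictionary.IsLevelFixed π.1 lam 𝔫 θ →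
      (fun I : Fin (q + 1) → Fin (ResGLnCartan.pZeroDim n K) =>
        @id (π.1.W ⊗[ℂ] ResGLnCohomology.CoeffModule ℂ n K lam) (θ (fun i => ConeDictionary.xD n K hcpt (I i)))) ∈ Zs := by
  -- the finite-dimensional right-`K_∞`-stable space `M` of matrix coefficients of `Mult(𝔤^{q+1}, E)`
  obtain ⟨M, hMfin, hMstab, hMmem⟩ := EndFD.exists_matrixCoeff_submodule_datum hcpt S lam q
  haveI := hMfin
  -- Harish-Chandra finiteness at level `K(𝔫)` with slices in `M` (landed FD-SLICE)
  obtain ⟨T, hTfin, hT⟩ := stub_finiteDimensional_levelKSlice hcpt 𝔫 h𝔫 π hbot M hMstab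
  haveI := hTfin
  -- every coordinate of every value of an admissible `θ` lies in `T`
  have hcoord : ∀ θ : ConeDictionary.Cochain π.1 lam (q + 1),
      θ ∈ (ConeDictionary.gkComplexLS π.1 S lam).carrier (q + 1) → ConeDictionary.IsLevelFixed π.1 lam 𝔫 θ →
      ∀ (μ : ResGLnCohomology.CoeffModule ℂ n K lam →ₗ[ℂ] ℂ)
        (v : Fin (q + 1) → (AutomorphyDatum.gl n K hcpt).arch.lie),
        ((TensorProduct.rid ℂ π.1.W (μ.lTensor π.1.W
          (@id (π.1.W ⊗[ℂ] ResGLnCohomology.CoeffModule ℂ n K lam) (θ v))) : π.1.W) :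
            (AdelicGroupData.gl n K).Adelic → ℂ) ∈ T :=
    fun θ hθ hlev μ v => EndFD.coe_coord_mem π.1 S lam hθ hlev hMmem hT μ v
  -- a basis of `E`, the finite-dimensional `T ∩ W ≤ W`, and the image `V` of `(T ∩ W) ⊗ E` in `W ⊗ E`
  let b := Module.finBasis ℂ (ResGLnCohomology.CoeffModule ℂ n K lam)
  let TW : Submodule ℂ π.1.W := T.comap π.1.W.subtype
  haveI hTWfin : FiniteDimensional ℂ TW :=
    FiniteDimensional.of_injective ((π.1.W.subtype ∘ₗ TW.subtype).codRestrict T fun x => x.2)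
      fun x y hxy => by
        have h2 := congrArg Subtype.val hxy
        exact Subtype.ext (Subtype.ext h2)
  let V : Submodule ℂ (π.1.W ⊗[ℂ] ResGLnCohomology.CoeffModule ℂ n K lam) :=
    LinearMap.range (TW.subtype.rTensor (ResGLnCohomology.CoeffModule ℂ n K lam))
  have hVfin : Module.Finite ℂ V := Module.Finite.range _
  refine ⟨Submodule.pi Set.univ fun _ => V,
    Module.Finite.iff_fg.mpr (Submodule.fg_pi fun _ => Module.Finite.iff_fg.mp hVfin), ?_⟩
  intro θ hθ _hrel hlev
  -- every tuple value lies in `V`: reconstruct it from its coordinates, which lie in `T ∩ W`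
  refine Submodule.mem_pi.2 fun I _ => LinearMap.mem_range.2 ?_
  refine ⟨∑ i, (⟨TensorProduct.rid ℂ π.1.W ((b.coord i).lTensor π.1.W
      (@id (π.1.W ⊗[ℂ] ResGLnCohomology.CoeffModule ℂ n K lam)
        (θ fun j => ConeDictionary.xD n K hcpt (I j)))),
      hcoord θ hθ hlev (b.coord i) fun j => ConeDictionary.xD n K hcpt (I j)⟩ : TW) ⊗ₜ[ℂ] b i, ?_⟩
  rw [map_sum]
  simp only [LinearMap.rTensor_tmul, Submodule.subtype_apply]
  exact EndFD.sum_rid_lTensor_coord_tmul b _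

end Summit.Langlands.Langlands.Theorems.HeckeEigenvalueField.Res

end
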